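/-
Origin: expansion seat `prover-pub-hodgecm-mc-sinst-1-g11-0`, handover #1265 2026-08-21T03:02Z md5 cc2a0f912f67 (314 l.; NEW additive leaf, ns HodgeCM.Model.ThetaAdelicSide, hypotheses on η₁: hη₁c (continuity), hη₁V (η₁(v,1)=1 on CMRat (frameD V)), hη₁W (η₁(1,ũ)=1 for rational ũ): adelicLinePairEquiv_adelicInr_eq_cmCenter_one, twistCharW_bigCharOne_eq, adelicCharOne_cmCenter_symm_eq_one, twistCharW_bigCharOne_rationalToFinAdelic, cWOneG_eq_torusScalar_oneG_finLineTorus, torusScalar_oneG_symm_eq_one_of, cWOneG_rationalToFinAdelic, psiOneG_rationalToFinAdelic, charOneDictG_rationalToFinAdelic, hasRationalRestriction_charOneDictG_one (hχinf : ∀ t, χ(♯(t,1_f))·torusScalar_oneG η₁ (u_t) = adelicCharOne η₁ (CMCenter (frameD V) u_t)) + _of_weight, continuous_torusScalar_oneG_val_of, continuous_adelicCharOne_val, continuous_cWOneG, continuous_twistCharW_bigCharOne, continuous_charOneDictG, isLevelTrivial_charOneDictG (UNCONDITIONAL), isAutChar_charOneDictG + _of_weight; NAMES for audit: HodgeCM.Model.ThetaAdelicSide.charOneDictG_rationalToFinAdelic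 · HodgeCM.Model.ThetaAdelicSide.isLevelTrivial_charOneDictG · HodgeCM.Model.ThetaAdelicSide.isAutChar_charOneDictG) (`HOME/mc/pub-hodgecm-mc-sinst-1-g11/stage70/HodgeCM/Model/AdelicThetaSlotOneAutG.lean`, md5 cc2a0f912f67, 314 lines);
landed by the gen-30 packager (p-g30) in gate run 71 as `HodgeCM/Model/AdelicThetaSlotOneAutG.lean` (verbatim).
-/
/-
Copyright (c) 2026 the pub-hodgecm formalisation cell (harness21).  New file, not vendored.
Origin: session prover-pub-hodgecm-mc-sinst-1-g11-0 (unit pub-hodgecm-mc-sinst-1-g11, S-INSTANCE CONSTRUCTOR gen 11; the AUTOMORPHY of the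
slot-1 dictionary character over the G-datum — generic slot character `η₁`, twisted record `splitLineOneTwistedG` of
`Model/AdelicThetaSlotOneBridgeG`; the R2 pin of record is an instance), 2026-08-21.
Intended final place: `HodgeCM/Model/AdelicThetaSlotOneAutG.lean` (NEW additive model-layer leaf; imports sinst-1 `Model/AdelicThetaSlotOneBridgeG`
and #1260 `Model/AdelicThetaDistributionAut` (rational-point bookkeeping, `chiOne_rationalToFinAdelic`, `charInv_injective`); nothing imports it;
drop alone).
-/
import Summits.HodgeConjecture.HodgeCM.Model.AdelicThetaSlotOneBridgeG
import Summits.HodgeConjecture.HodgeCM.Model.AdelicThetaDistributionAut_2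

set_option autoImplicit false

/-!
# The slot-1 dictionary character `χ″₁(η₁, χ) = charOneDictG η₁ χ` is automorphic ON THE WEIGHT SET modulo one archimedean identity

For a GENERIC slot character `η₁` (hypotheses: `hη₁c` continuity, `hη₁V : η₁(γ, 1) = 1` on `U(diag frameD V)(L⁺)`, `hη₁W : η₁(1, ũ) = 1` for
rational `ũ`), on the twisted record `splitLineOneTwistedG η₁` (`Model/AdelicThetaSlotOneBridgeG`):
* § 1 `adelicLinePairEquiv_adelicInr_eq_cmCenter_one`, **`twistCharW_bigCharOne_eq`** (`twistCharW ĉ₁(η₁) = adelicCharOne η₁ ∘ CMCenter ∘ finLineTorus`),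
  `cWOneG_eq_torusScalar_oneG_finLineTorus`, `torusScalar_oneG_symm_eq_one_of` (rational points, from `hη₁W` + [Weil1964, Thm 6]),
  **`charOneDictG_rationalToFinAdelic`**: `χ″₁(γ_f) = adelicCharOne η₁ ((t_γ,1_f) · 1_V)⁻¹ · χ(♯(t_γ,1_f)) · torusScalar_oneG η₁ (u_{t_γ})`;
* § 2 **`hasRationalRestriction_charOneDictG_one`** under the ONE archimedean identity
  `hχinf : ∀ t, χ(♯(t,1_f)) · torusScalar_oneG η₁ (u_t) = adelicCharOne η₁ ((t,1_f) · 1_V)` (for `χ` on the slot's weight set = (Hw₁)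
  `w₁ t · adelicCharOne η₁ (CMCenter (frameD V) u_t) = torusScalar_oneG η₁ (u_t)` — the archimedean centre acts trivially on the slot's
  archimedean vector; theta-3's `hasCentralTypeAt_twistBy_iff`), `…_of_weight`;
* § 3 continuity ⇒ **`isLevelTrivial_charOneDictG`** UNCONDITIONALLY (`hη₁c`, `h₁W`); **`isAutChar_charOneDictG`** (+ `_of_weight`).
KERNEL only: 0 records, 0 `def … : Prop`, nothing cited as a hypothesis; `#print axioms` ⊆ {propext, Classical.choice, Quot.sound}.
-/

noncomputable section

open MulAction IsDedekindDomain NumberField.mixedEmbedding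
open NumberField hiding relNormOneIdeles relNormOneRat probHaarRelNormOneQuot relNormOneInfUnits relNormOneInfToIdeles
open scoped Matrix TensorProduct Classical SchwartzMap
open Literature.NumberTheory.Automorphic Literature.NumberTheory.Weil1964
open Literature.NumberTheory.GelbartRogawski1991 Literature.NumberTheory.GelbartRogawski1991.UnitaryDualPair
open Literature.RepresentationTheory (SeesawScalar.twist SeesawScalar.twist_apply)
open Literature.Geometry.ComplexHyperbolic.BallModel (U21 x₀)
open Literature.AlgebraicGeometry.ShimuraVarieties
open HodgeCM.Adelic HodgeCM.PerL34 HodgeCM.Model.ArchSideTerm HodgeCM.Model.ThetaDistFin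
open Literature.NumberTheory.Automorphic.UnitaryGroup (cmAdelicOneEquivRelNormOne)

namespace HodgeCM.Model
namespace ThetaAdelicSide

variable {L : CMField} {ι₁ : L →+* ℂ} (V : HermSpace3 L ι₁) (c : SeesawCtx L)
  (hGR : (cmSplittingDatum (L : Type) finProdFinEquiv (frameD V) (frameD_real V) (frameD_ne V) (dW c.D) (dW_real c.D)
    (dW_ne c.D)).CompatibleSplitting)
  (hGR₀ : (cmSplittingDatum (L : Type) (e₁) (frameD V) (frameD_real V) (frameD_ne V) (lineVec (L : Type) (dW c.D 0))
    (fun _ => dW_real c.D 0) (fun _ => dW_ne c.D 0)).CompatibleSplitting)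
  (hGR₁ : (cmSplittingDatum (L : Type) (e₁) (frameD V) (frameD_real V) (frameD_ne V) (lineVec (L : Type) (dW c.D 1))
    (fun _ => dW_real c.D 1) (fun _ => dW_ne c.D 1)).CompatibleSplitting)
  (η₁ : CMAdelic (L : Type) (frameD V) × CMAdelicOne (L : Type) →* ℂˣ)
  (hη₁c : Continuous fun p => ((η₁ p : ℂˣ) : ℂ))
  (hη₁V : ∀ v ∈ CMRat (L : Type) (frameD V), η₁ (v, 1) = 1)
  (hη₁W : ∀ t₀ ∈ relNormOneRat (↥(maximalRealSubfield L)) L, η₁ (1, (cmAdelicOneEquivRelNormOne (L : Type)).symm t₀) = 1)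
  (h₁W : (∀ j, 0 < (ι₁ (dW c.D j)).re) ∨ ∀ j, (ι₁ (dW c.D j)).re < 0)
  (χ : PontryaginDual (↥(relNormOneIdeles (↥(maximalRealSubfield L)) L) ⧸ relNormOneRat (↥(maximalRealSubfield L)) L))

/-! ## § 1. Values on rational points -/

/-- the line identification of #1255 for the line `⟨a₁⟩` takes `1 ⊗ w` to the CENTRE element `(det w) · 1_V`. -/
theorem adelicLinePairEquiv_adelicInr_eq_cmCenter_one (w : CMAdelic (L : Type) (lineVec (L : Type) (dW c.D 1))) :
    LinePair.adelicLinePairEquiv (↥(maximalRealSubfield L)) (L : Type) (IsCMField.complexConj L) 3 (Matrix.diagonal (frameD V))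
        (Matrix.diagonal (lineVec (L : Type) (dW c.D 1))) (lineVec_dW_one_ne c)
        (UnitaryGroup.adelicInr (↥(maximalRealSubfield L)) (L : Type) (IsCMField.complexConj L) 3 1 (Matrix.diagonal (frameD V))
          (Matrix.diagonal (lineVec (L : Type) (dW c.D 1))) w) =
      CMCenter (L : Type) (frameD V) (cmAdelicDet (L : Type) (lineVec (L : Type) (dW c.D 1)) (fun _ => dW_ne c.D 1) w) := by
  apply Subtype.ext
  apply Units.ext
  rw [LinePair.coe_adelicLinePairEquiv_adelicInr, UnitaryGroup.coe_adelicCenter, coe_cmAdelicDet, Matrix.GeneralLinearGroup.val_det_apply,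
    Matrix.det_unique]

/-- **`twistCharW ĉ₁(η₁) u = adelicCharOne η₁ ((det (1_∞, u)) · 1_V)`**. -/
theorem twistCharW_bigCharOne_eq (u : UfOne c.D) :
    HodgeCM.WeilCoinv.twistCharW (↥(maximalRealSubfield L)) (L : Type) (IsCMField.complexConj L) 3 1
        (Matrix.diagonal (frameD V)) (splitLineOne V c hGR₁).JW (bigCharOne V c hGR hGR₀ hGR₁ η₁) u =
      adelicCharOne V c hGR hGR₀ hGR₁ η₁ (CMCenter (L : Type) (frameD V) (finLineTorus (L : Type) (dW c.D 1) (dW_ne c.D 1) u)) := by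
  show HodgeCM.WeilCoinv.twistCharW (↥(maximalRealSubfield L)) (L : Type) (IsCMField.complexConj L) 3 1
      (Matrix.diagonal (frameD V)) (Matrix.diagonal (lineVec (L : Type) (dW c.D 1))) (bigCharOne V c hGR hGR₀ hGR₁ η₁) u = _
  rw [bigCharOne, LinePair.twistCharW_bigCharOfV_apply, adelicLinePairEquiv_adelicInr_eq_cmCenter_one, finLineTorus_apply]

include hη₁V in
/-- `adelicCharOne η₁` is trivial on the RATIONAL centre. -/
theorem adelicCharOne_cmCenter_symm_eq_one {t₀ : ↥(relNormOneIdeles (↥(maximalRealSubfield L)) L)}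
    (ht₀ : t₀ ∈ relNormOneRat (↥(maximalRealSubfield L)) L) :
    adelicCharOne V c hGR hGR₀ hGR₁ η₁ (CMCenter (L : Type) (frameD V) ((cmAdelicOneEquivRelNormOne (L : Type)).symm t₀)) = 1 :=
  adelicCharOne_eq_one_of_rat V c hGR hGR₀ hGR₁ η₁ hη₁V
    (UnitaryGroup.cm_adelicCenter_symm_mem_range_toAdelic (L : Type) 3 (Matrix.diagonal (frameD V)) t₀ ht₀)

include hη₁V in
/-- **`twistCharW ĉ₁(η₁) (γ_f) = adelicCharOne η₁ ((t_γ, 1_f) · 1_V)⁻¹`** on a rational point. -/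
theorem twistCharW_bigCharOne_rationalToFinAdelic
    (γ : ↥(UnitaryGroup.rational (↥(maximalRealSubfield L)) (L : Type) (IsCMField.complexConj L) 1
      (Matrix.diagonal (lineVec (L : Type) (dW c.D 1))))) :
    HodgeCM.WeilCoinv.twistCharW (↥(maximalRealSubfield L)) (L : Type) (IsCMField.complexConj L) 3 1
        (Matrix.diagonal (frameD V)) (splitLineOne V c hGR₁).JW (bigCharOne V c hGR hGR₀ hGR₁ η₁)
        (UnitaryGroup.rationalToFinAdelic (↥(maximalRealSubfield L)) (L : Type) (IsCMField.complexConj L) 1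
          (Matrix.diagonal (lineVec (L : Type) (dW c.D 1))) γ) =
      (adelicCharOne V c hGR hGR₀ hGR₁ η₁ (CMCenter (L : Type) (frameD V) (ratInfOne (L : Type) (dW c.D 1) (dW_ne c.D 1) γ)))⁻¹ := by
  rw [twistCharW_bigCharOne_eq, finLineTorus_rationalToFinAdelic, map_mul, map_inv, map_mul, map_inv,
    adelicCharOne_cmCenter_symm_eq_one V c hGR hGR₀ hGR₁ η₁ hη₁V (ratDetIdele_mem_relNormOneRat (L : Type) (dW c.D 1) (dW_ne c.D 1) γ),
    mul_one]
  rfl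

/-- `cWOneG η₁ = torusScalar_oneG η₁ ∘ finLineTorus`. -/
theorem cWOneG_eq_torusScalar_oneG_finLineTorus (u : UfOne c.D) :
    cWOneG V c hGR hGR₀ hGR₁ η₁ u =
      torusScalar_oneG V c.D hGR hGR₀ hGR₁ η₁ (finLineTorus (L : Type) (dW c.D 1) (dW_ne c.D 1) u) := by
  rw [cWOneG_apply, finCharOne_apply, finPairDOne_apply, map_one, map_one, torusScalar_one_applyG, cmCenter_finLineTorus]
  rfl

include hη₁W in
/-- the torus scalar of line 1 at `η₁` is trivial on RATIONAL points (`hη₁W` + [Weil1964, Thm 6] `char₄_eq_one_of_rational`). -/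
theorem torusScalar_oneG_symm_eq_one_of {t₀ : ↥(relNormOneIdeles (↥(maximalRealSubfield L)) L)}
    (ht₀ : t₀ ∈ relNormOneRat (↥(maximalRealSubfield L)) L) :
    torusScalar_oneG V c.D hGR hGR₀ hGR₁ η₁ ((cmAdelicOneEquivRelNormOne (L : Type)).symm t₀) = 1 := by
  obtain ⟨γ₀, hγ₀⟩ := UnitaryGroup.cm_adelicCenter_symm_mem_range_toAdelic (L : Type) 1
    (Matrix.diagonal (lineVec (L : Type) (dW c.D 1))) t₀ ht₀
  have hχ1 : cmLineChar₁ (L : Type) finProdFinEquiv e₁ (frameD V) (frameD_real V) (frameD_ne V) (dW c.D) (dW_real c.D) (dW_ne c.D)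
      hGR hGR₀ hGR₁ (1, CMCenter (L : Type) (lineVec (L : Type) (dW c.D 1)) ((cmAdelicOneEquivRelNormOne (L : Type)).symm t₀)) = 1 := by
    rw [cmLineChar₁]
    simp only [MonoidHom.coe_comp, Function.comp_apply, MonoidHom.coe_snd]
    apply char₄_eq_one_of_rational
    · exact ratIsometry_one_lineVec (L : Type) (dW c.D)
    · exact ⟨γ₀, hγ₀⟩
  rw [torusScalar_one_applyG, hη₁W t₀ ht₀, hχ1, mul_one]

include hη₁W in
/-- `cWOneG η₁ (γ_f) = torusScalar_oneG η₁ (u_{t_γ})⁻¹`. -/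
theorem cWOneG_rationalToFinAdelic
    (γ : ↥(UnitaryGroup.rational (↥(maximalRealSubfield L)) (L : Type) (IsCMField.complexConj L) 1
      (Matrix.diagonal (lineVec (L : Type) (dW c.D 1))))) :
    cWOneG V c hGR hGR₀ hGR₁ η₁ (UnitaryGroup.rationalToFinAdelic (↥(maximalRealSubfield L)) (L : Type) (IsCMField.complexConj L) 1
        (Matrix.diagonal (lineVec (L : Type) (dW c.D 1))) γ) =
      (torusScalar_oneG V c.D hGR hGR₀ hGR₁ η₁ (ratInfOne (L : Type) (dW c.D 1) (dW_ne c.D 1) γ))⁻¹ := by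
  rw [cWOneG_eq_torusScalar_oneG_finLineTorus, finLineTorus_rationalToFinAdelic, map_mul, map_inv,
    torusScalar_oneG_symm_eq_one_of V c hGR hGR₀ hGR₁ η₁ hη₁W (ratDetIdele_mem_relNormOneRat (L : Type) (dW c.D 1) (dW_ne c.D 1) γ),
    mul_one]
  rfl

include hη₁W in
/-- `ψ₁(η₁, χ)(γ_f) = χ(♯(t_γ, 1_f)) · torusScalar_oneG η₁ (u_{t_γ})`. -/
theorem psiOneG_rationalToFinAdelic
    (γ : ↥(UnitaryGroup.rational (↥(maximalRealSubfield L)) (L : Type) (IsCMField.complexConj L) 1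
      (Matrix.diagonal (lineVec (L : Type) (dW c.D 1))))) :
    psiOneG V c hGR hGR₀ hGR₁ η₁ χ (UnitaryGroup.rationalToFinAdelic (↥(maximalRealSubfield L)) (L : Type) (IsCMField.complexConj L) 1
        (Matrix.diagonal (lineVec (L : Type) (dW c.D 1))) γ) =
      Circle.toUnits (χ (QuotientGroup.mk
          (relNormOneInfToIdeles (↥(maximalRealSubfield L)) L (ratInfPart (L : Type) (dW c.D 1) (dW_ne c.D 1) γ)))) *
        torusScalar_oneG V c.D hGR hGR₀ hGR₁ η₁ (ratInfOne (L : Type) (dW c.D 1) (dW_ne c.D 1) γ) := by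
  rw [psiOneG, MonoidHom.mul_apply, MonoidHom.inv_apply, chiOne_rationalToFinAdelic, cWOneG_rationalToFinAdelic V c hGR hGR₀ hGR₁ η₁ hη₁W,
    inv_inv]

include hη₁V hη₁W in
/-- **`χ″₁(γ_f) = adelicCharOne η₁ ((t_γ,1_f) · 1_V)⁻¹ · (χ(♯(t_γ, 1_f)) · torusScalar_oneG η₁ (u_{t_γ}))`** — an ARCHIMEDEAN quantity. -/
theorem charOneDictG_rationalToFinAdelic
    (γ : ↥(UnitaryGroup.rational (↥(maximalRealSubfield L)) (L : Type) (IsCMField.complexConj L) 1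
      (Matrix.diagonal (lineVec (L : Type) (dW c.D 1))))) :
    charOneDictG V c hGR hGR₀ hGR₁ η₁ χ (UnitaryGroup.rationalToFinAdelic (↥(maximalRealSubfield L)) (L : Type)
        (IsCMField.complexConj L) 1 (Matrix.diagonal (lineVec (L : Type) (dW c.D 1))) γ) =
      (adelicCharOne V c hGR hGR₀ hGR₁ η₁ (CMCenter (L : Type) (frameD V) (ratInfOne (L : Type) (dW c.D 1) (dW_ne c.D 1) γ)))⁻¹ *
        (Circle.toUnits (χ (QuotientGroup.mk
            (relNormOneInfToIdeles (↥(maximalRealSubfield L)) L (ratInfPart (L : Type) (dW c.D 1) (dW_ne c.D 1) γ)))) *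
          torusScalar_oneG V c.D hGR hGR₀ hGR₁ η₁ (ratInfOne (L : Type) (dW c.D 1) (dW_ne c.D 1) γ)) := by
  rw [charOneDictG, MonoidHom.mul_apply, twistCharW_bigCharOne_rationalToFinAdelic V c hGR hGR₀ hGR₁ η₁ hη₁V]
  exact congrArg _ (psiOneG_rationalToFinAdelic V c hGR hGR₀ hGR₁ η₁ hη₁W χ γ)

/-! ## § 2. Rational triviality from ONE archimedean identity -/

include hη₁V hη₁W in
/-- **`χ″₁` IS TRIVIAL ON `U(⟨a₁⟩)(L⁺)`** as soon as `χ(♯(t,1_f)) · torusScalar_oneG η₁ (u_t) = adelicCharOne η₁ ((t,1_f) · 1_V)` on the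
archimedean torus. -/
theorem hasRationalRestriction_charOneDictG_one
    (hχinf : ∀ t : ↥(relNormOneInfUnits (↥(maximalRealSubfield L)) L),
      ((χ (QuotientGroup.mk (relNormOneInfToIdeles (↥(maximalRealSubfield L)) L t)) : Circle) : ℂ) *
          ((torusScalar_oneG V c.D hGR hGR₀ hGR₁ η₁
            ((cmAdelicOneEquivRelNormOne (L : Type)).symm (relNormOneInfToIdeles (↥(maximalRealSubfield L)) L t)) : ℂˣ) : ℂ) =
        ((adelicCharOne V c hGR hGR₀ hGR₁ η₁ (CMCenter (L : Type) (frameD V)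
            ((cmAdelicOneEquivRelNormOne (L : Type)).symm (relNormOneInfToIdeles (↥(maximalRealSubfield L)) L t))) : ℂˣ) : ℂ)) :
    (splitLineOneTwistedG V c hGR hGR₀ hGR₁ η₁ hη₁V).HasRationalRestriction (charOneDictG V c hGR hGR₀ hGR₁ η₁ χ) 1 := by
  rw [SplitLine.hasRationalRestriction_iff]
  intro γ
  have h := charOneDictG_rationalToFinAdelic V c hGR hGR₀ hGR₁ η₁ hη₁V hη₁W χ γ
  have hne : adelicCharOne V c hGR hGR₀ hGR₁ η₁ (CMCenter (L : Type) (frameD V) (ratInfOne (L : Type) (dW c.D 1) (dW_ne c.D 1) γ)) *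
      1 = adelicCharOne V c hGR hGR₀ hGR₁ η₁ (CMCenter (L : Type) (frameD V) (ratInfOne (L : Type) (dW c.D 1) (dW_ne c.D 1) γ)) *
        ((adelicCharOne V c hGR hGR₀ hGR₁ η₁ (CMCenter (L : Type) (frameD V) (ratInfOne (L : Type) (dW c.D 1) (dW_ne c.D 1) γ)))⁻¹ *
          (Circle.toUnits (χ (QuotientGroup.mk
              (relNormOneInfToIdeles (↥(maximalRealSubfield L)) L (ratInfPart (L : Type) (dW c.D 1) (dW_ne c.D 1) γ)))) *
            torusScalar_oneG V c.D hGR hGR₀ hGR₁ η₁ (ratInfOne (L : Type) (dW c.D 1) (dW_ne c.D 1) γ))) := by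
    rw [mul_one, mul_inv_cancel_left]
    apply Units.ext
    rw [Units.val_mul]
    exact (hχinf _).symm
  rw [MonoidHom.one_apply]
  exact h.trans (mul_left_cancel hne).symm

include hη₁V hη₁W in
/-- the same from the WEIGHT identity and (Hw₁) `w t · adelicCharOne η₁ ((t,1_f) · 1_V) = torusScalar_oneG η₁ (u_t)`. -/
theorem hasRationalRestriction_charOneDictG_one_of_weight (w : ↥(relNormOneInfUnits (↥(maximalRealSubfield L)) L) → ℂ)
    (hχw : ∀ t : ↥(relNormOneInfUnits (↥(maximalRealSubfield L)) L),
      ((χ (QuotientGroup.mk (relNormOneInfToIdeles (↥(maximalRealSubfield L)) L t)) : Circle) : ℂ) * w t = 1)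
    (hw : ∀ t : ↥(relNormOneInfUnits (↥(maximalRealSubfield L)) L),
      w t * ((adelicCharOne V c hGR hGR₀ hGR₁ η₁ (CMCenter (L : Type) (frameD V)
            ((cmAdelicOneEquivRelNormOne (L : Type)).symm (relNormOneInfToIdeles (↥(maximalRealSubfield L)) L t))) : ℂˣ) : ℂ) =
        ((torusScalar_oneG V c.D hGR hGR₀ hGR₁ η₁
            ((cmAdelicOneEquivRelNormOne (L : Type)).symm (relNormOneInfToIdeles (↥(maximalRealSubfield L)) L t)) : ℂˣ) : ℂ)) :
    (splitLineOneTwistedG V c hGR hGR₀ hGR₁ η₁ hη₁V).HasRationalRestriction (charOneDictG V c hGR hGR₀ hGR₁ η₁ χ) 1 := by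
  refine hasRationalRestriction_charOneDictG_one V c hGR hGR₀ hGR₁ η₁ hη₁V hη₁W χ fun t => ?_
  rw [← hw t, ← mul_assoc, hχw t, one_mul]

/-! ## § 3. Level triviality (continuity) and `IsAutChar` -/

include hη₁c h₁W in
/-- carch's torus scalar of line 1 at `η₁` has continuous values. -/
theorem continuous_torusScalar_oneG_val_of :
    Continuous fun u : CMAdelicOne (L : Type) => ((torusScalar_oneG V c.D hGR hGR₀ hGR₁ η₁ u : ℂˣ) : ℂ) := by
  have h1 : Continuous fun u : CMAdelicOne (L : Type) => ((η₁ (1, u) : ℂˣ) : ℂ) := hη₁c.comp (continuous_const.prodMk continuous_id)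
  have h2 : Continuous fun u : CMAdelicOne (L : Type) =>
      ((cmLineChar₁ (L : Type) finProdFinEquiv e₁ (frameD V) (frameD_real V) (frameD_ne V) (dW c.D) (dW_real c.D) (dW_ne c.D) hGR hGR₀
        hGR₁ (1, CMCenter (L : Type) (lineVec (L : Type) (dW c.D 1)) u) : ℂˣ) : ℂ) :=
    (continuous_cmLineChar₁_of_signs (L : Type) finProdFinEquiv e₁ (frameD V) (frameD_real V) (frameD_ne V) (dW c.D) (dW_real c.D)
        (dW_ne c.D) hGR hGR₀ hGR₁ ι₁ (frameD_sign_ι₁' V) h₁W (frameD_sign_of_ne V)).comp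
      (continuous_const.prodMk (continuous_adelicCenter _ _ _ _ _))
  simp only [torusScalar_one_applyG, Units.val_mul]
  exact h1.mul h2

include hη₁c h₁W in
/-- the adelic `V`-character `adelicCharOne η₁` has continuous values. -/
theorem continuous_adelicCharOne_val :
    Continuous fun v : CMAdelic (L : Type) (frameD V) => ((adelicCharOne V c hGR hGR₀ hGR₁ η₁ v : ℂˣ) : ℂ) := by
  have h1 : Continuous fun v : CMAdelic (L : Type) (frameD V) => ((η₁ (v, 1) : ℂˣ) : ℂ) := hη₁c.comp (continuous_id.prodMk continuous_const)
  have h2 : Continuous fun v : CMAdelic (L : Type) (frameD V) =>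
      ((cmLineChar₁ (L : Type) finProdFinEquiv e₁ (frameD V) (frameD_real V) (frameD_ne V) (dW c.D) (dW_real c.D) (dW_ne c.D) hGR hGR₀
        hGR₁ (v, 1) : ℂˣ) : ℂ) :=
    (continuous_cmLineChar₁_of_signs (L : Type) finProdFinEquiv e₁ (frameD V) (frameD_real V) (frameD_ne V) (dW c.D) (dW_real c.D)
        (dW_ne c.D) hGR hGR₀ hGR₁ ι₁ (frameD_sign_ι₁' V) h₁W (frameD_sign_of_ne V)).comp
      (continuous_id.prodMk continuous_const)
  simp only [adelicCharOne_apply, Units.val_mul]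
  exact h1.mul h2

include hη₁c h₁W in
/-- `cWOneG η₁` is continuous (into `ℂˣ`). -/
theorem continuous_cWOneG : Continuous (cWOneG V c hGR hGR₀ hGR₁ η₁) := by
  apply (cWOneG V c hGR hGR₀ hGR₁ η₁).continuous_of_continuous_units_val
  have hf : Continuous (finLineTorus (L : Type) (dW c.D 1) (dW_ne c.D 1)) :=
    (continuous_cmAdelicDet (L : Type) (lineVec (L : Type) (dW c.D 1)) fun _ => dW_ne c.D 1).comp
      (UnitaryGroup.continuous_finAdelicToAdelic _ _ _ _ _)
  simp only [cWOneG_eq_torusScalar_oneG_finLineTorus]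
  exact (continuous_torusScalar_oneG_val_of V c hGR hGR₀ hGR₁ η₁ hη₁c h₁W).comp hf

include hη₁c h₁W in
/-- the `W`-part of `ĉ₁(η₁)` is continuous (into `ℂˣ`). -/
theorem continuous_twistCharW_bigCharOne :
    Continuous (HodgeCM.WeilCoinv.twistCharW (↥(maximalRealSubfield L)) (L : Type) (IsCMField.complexConj L) 3 1
      (Matrix.diagonal (frameD V)) (splitLineOne V c hGR₁).JW (bigCharOne V c hGR hGR₀ hGR₁ η₁)) := by
  apply MonoidHom.continuous_of_continuous_units_val
  have hf : Continuous (finLineTorus (L : Type) (dW c.D 1) (dW_ne c.D 1)) :=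
    (continuous_cmAdelicDet (L : Type) (lineVec (L : Type) (dW c.D 1)) fun _ => dW_ne c.D 1).comp
      (UnitaryGroup.continuous_finAdelicToAdelic _ _ _ _ _)
  simp only [twistCharW_bigCharOne_eq]
  exact (continuous_adelicCharOne_val V c hGR hGR₀ hGR₁ η₁ hη₁c h₁W).comp ((continuous_adelicCenter _ _ _ _ _).comp hf)

include hη₁c h₁W in
/-- `χ″₁` is continuous (into `ℂˣ`). -/
theorem continuous_charOneDictG : Continuous (charOneDictG V c hGR hGR₀ hGR₁ η₁ χ) := by
  show Continuous fun u =>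
    HodgeCM.WeilCoinv.twistCharW (↥(maximalRealSubfield L)) (L : Type) (IsCMField.complexConj L) 3 1
        (Matrix.diagonal (frameD V)) (splitLineOne V c hGR₁).JW (bigCharOne V c hGR hGR₀ hGR₁ η₁) u *
      (chiOne c χ u * (cWOneG V c hGR hGR₀ hGR₁ η₁ u)⁻¹)
  exact (continuous_twistCharW_bigCharOne V c hGR hGR₀ hGR₁ η₁ hη₁c h₁W).mul
    ((continuous_chiOne c χ).mul (continuous_cWOneG V c hGR hGR₀ hGR₁ η₁ hη₁c h₁W).inv)

include hη₁c h₁W in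
/-- **`χ″₁` IS LEVEL-TRIVIAL** on the twisted slot-1 record — unconditionally. -/
theorem isLevelTrivial_charOneDictG :
    (splitLineOneTwistedG V c hGR hGR₀ hGR₁ η₁ hη₁V).IsLevelTrivial (charOneDictG V c hGR hGR₀ hGR₁ η₁ χ) := by
  obtain ⟨n₀, hn₀, h⟩ := UnitaryGroup.exists_nat_forall_dvd_finCongruenceLevel_le_ker (charOneDictG V c hGR hGR₀ hGR₁ η₁ χ)
    (continuous_charOneDictG V c hGR hGR₀ hGR₁ η₁ hη₁c h₁W χ).continuousAt
  exact ⟨n₀, hn₀, fun k hk => h n₀ hn₀ (dvd_refl _) k hk⟩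

include hη₁c hη₁W h₁W in
/-- **`χ″₁ = charOneDictG η₁ χ` IS A `GoodChar` OF THE TWISTED SLOT-1 RECORD** (`IsAutChar`) under the ONE archimedean identity — binder-2's
socket hypothesis `hχ` for slot 1, at every pin. -/
theorem isAutChar_charOneDictG
    (hχinf : ∀ t : ↥(relNormOneInfUnits (↥(maximalRealSubfield L)) L),
      ((χ (QuotientGroup.mk (relNormOneInfToIdeles (↥(maximalRealSubfield L)) L t)) : Circle) : ℂ) *
          ((torusScalar_oneG V c.D hGR hGR₀ hGR₁ η₁
            ((cmAdelicOneEquivRelNormOne (L : Type)).symm (relNormOneInfToIdeles (↥(maximalRealSubfield L)) L t)) : ℂˣ) : ℂ) =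
        ((adelicCharOne V c hGR hGR₀ hGR₁ η₁ (CMCenter (L : Type) (frameD V)
            ((cmAdelicOneEquivRelNormOne (L : Type)).symm (relNormOneInfToIdeles (↥(maximalRealSubfield L)) L t))) : ℂˣ) : ℂ)) :
    (splitLineOneTwistedG V c hGR hGR₀ hGR₁ η₁ hη₁V).IsAutChar (charOneDictG V c hGR hGR₀ hGR₁ η₁ χ) :=
  ⟨isLevelTrivial_charOneDictG V c hGR hGR₀ hGR₁ η₁ hη₁c hη₁V h₁W χ,
    hasRationalRestriction_charOneDictG_one V c hGR hGR₀ hGR₁ η₁ hη₁V hη₁W χ hχinf⟩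

include hη₁c hη₁W h₁W in
/-- the same from the WEIGHT identity and (Hw₁). -/
theorem isAutChar_charOneDictG_of_weight (w : ↥(relNormOneInfUnits (↥(maximalRealSubfield L)) L) → ℂ)
    (hχw : ∀ t : ↥(relNormOneInfUnits (↥(maximalRealSubfield L)) L),
      ((χ (QuotientGroup.mk (relNormOneInfToIdeles (↥(maximalRealSubfield L)) L t)) : Circle) : ℂ) * w t = 1)
    (hw : ∀ t : ↥(relNormOneInfUnits (↥(maximalRealSubfield L)) L),
      w t * ((adelicCharOne V c hGR hGR₀ hGR₁ η₁ (CMCenter (L : Type) (frameD V)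
            ((cmAdelicOneEquivRelNormOne (L : Type)).symm (relNormOneInfToIdeles (↥(maximalRealSubfield L)) L t))) : ℂˣ) : ℂ) =
        ((torusScalar_oneG V c.D hGR hGR₀ hGR₁ η₁
            ((cmAdelicOneEquivRelNormOne (L : Type)).symm (relNormOneInfToIdeles (↥(maximalRealSubfield L)) L t)) : ℂˣ) : ℂ)) :
    (splitLineOneTwistedG V c hGR hGR₀ hGR₁ η₁ hη₁V).IsAutChar (charOneDictG V c hGR hGR₀ hGR₁ η₁ χ) :=
  ⟨isLevelTrivial_charOneDictG V c hGR hGR₀ hGR₁ η₁ hη₁c hη₁V h₁W χ,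
    hasRationalRestriction_charOneDictG_one_of_weight V c hGR hGR₀ hGR₁ η₁ hη₁V hη₁W χ w hχw hw⟩

end ThetaAdelicSide
end HodgeCM.Model

end
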